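import Literature.MathematicalPhysics.QuantumLattice.GrassmannLaplacianVacuumBound
import Literature.MathematicalPhysics.QuantumLattice.GrassmannTruncatedBoundDB
import HarnessLib

/-!
# Tree-level vanishing and vacuum bounds for DETERMINANT-BOUNDED covariances (twin of parts of
# `GrassmannCumulantKernelBound` and `GrassmannLaplacianVacuumBound`)

Topic `MathematicalPhysics/QuantumLattice`; continuation of `GrassmannTruncatedBoundDB`.  Three tree-level lemmas of the
Laplacian-host engine re-run VERBATIM with the Gram form replaced by `IsGramBounded` (`GrassmannDeterminantBounded`):

* `kernel_ursellOf_kernelVertex_eq_zero_of_lt_of_gramBounded` — the `r`-kernels of `𝓔ᵀ` of `n` kernel vertices vanish below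
  `r + 2(n-1)` fields;
* `sum_filter_norm_kernel_zero_treeFactor_le_of_gramBounded`, **`norm_kernel_zero_ursellOf_kernelVertex_le_of_gramBounded`** — the
  degree-`0` (vacuum) tree bound with one vertex pinned (BGM 2006, (2.77) in degree `0`).

Everything is proved; no definition, no named fact.

## Sources

G. Benfatto, A. Giuliani, V. Mastropietro, Ann. Henri Poincaré 7 (2006) 809–898, (2.13)–(2.14), (2.66)–(2.80)
[`BenfattoGiulianiMastropietro2006`]; W. de Siqueira Pedra, M. Salmhofer, Comm. Math. Phys. 282 (2008) 797–818, Thm 1.3, Thm 2.4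
[`PedraSalmhofer2008`]; K. Gawȩdzki, A. Kupiainen, Comm. Math. Phys. 102 (1985) 1–30 [`GawedzkiKupiainen1985GrossNeveu`].
-/

noncomputable section

namespace Literature.MathematicalPhysics.QuantumLattice

open GrassmannAlgebra Finset MvPolynomial Literature.RingTheory.MvPolynomial
open Literature.Probability.LatticeModels Literature.Probability.LatticeModels.BattleFederbush
open Literature.MeasureTheory.Integral
open scoped InnerProductSpace

variable {𝕜 : Type*} [RCLike 𝕜] {Γ : Type*} [Fintype Γ] [DecidableEq Γ] {n : ℕ}
variable (C : Matrix Γ Γ 𝕜) (cl : Γ → Fin n) {deg : Fin n → ℕ} (K : ∀ v : Fin n, (Fin (deg v) → Γ) → 𝕜)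

/-- (Twin of `kernel_ursellOf_kernelVertex_eq_zero_of_lt` under `IsGramBounded`.) **With fewer than `r + 2(n-1)` fields the `r`-kernels of the truncated expectation of `n` kernel vertices
vanish** (every tree has `n - 1` lines deleting two fields each; BGM 2006, (2.66)). [cite: BenfattoGiulianiMastropietro2006, (2.66)] -/
theorem kernel_ursellOf_kernelVertex_eq_zero_of_lt_of_gramBounded {κ : ℝ} (hκ : 0 ≤ κ) (hGB : IsGramBounded C κ)
    (hm : ∀ v, Even (deg v)) (hK : ∀ v Yv, K v Yv ≠ 0 → ∀ j, cl (Yv j) = v) (v₀ : Fin n) {r : ℕ}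
    (hlt : (∑ v, deg v) < r + 2 * (n - 1)) (W : Fin r → Γ) :
    kernel 𝕜 ((ursellOf (convMoment 𝕜 C (kernelVertex 𝕜 hm K)) univ : evenPart 𝕜 Γ) : GrassmannAlgebra 𝕜 Γ) r W = 0 := by
  refine norm_le_zero_iff.1 ((norm_kernel_ursellOf_kernelVertex_le C cl K hm hK v₀ r W).trans (le_of_eq ?_))
  refine sum_eq_zero fun Ys _ => ?_
  rw [sum_eq_zero fun k _ => ?_, mul_zero]
  refine sum_eq_zero fun s _ => ?_
  split_ifs with h
  · have hk : k = n - 1 := by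
      have h' := Script.card_image_y s h.1
      rw [h.2, card_univ, Fintype.card_fin] at h'
      omega
    have hb := norm_kernel_treeFactor_genProd_le_of_gramBounded C cl hκ hGB s h.1 (flat Ys) W
    rw [patSet_eq_empty_of_card_lt _ _ (by rw [card_univ, Fintype.card_fin, totalCost_scriptOps]; omega), sum_empty,
      mul_zero, zero_mul] at hb
    exact le_antisymm hb (norm_nonneg _)
  · rfl

/-- (Twin of `sum_filter_norm_kernel_zero_treeFactor_le` under `IsGramBounded`.) **One script, no output fields, the first field `j₀` of the root vertex pinned at `w`**:
`Σ_{Y : Y_{v₀}(j₀) = w} ∏‖K‖ ‖kernel_0 (treeFactor s ψ(flat Y))‖ ≤ κ^{N-2k} (∏ N_u) (∏_{ℓ ∈ lines} α m m'_ℓ) ∫ w_s`.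
[cite: BenfattoGiulianiMastropietro2006, (2.77)] -/
theorem sum_filter_norm_kernel_zero_treeFactor_le_of_gramBounded {κ : ℝ} (hκ : 0 ≤ κ) (hGB : IsGramBounded C κ)
    (hK : ∀ v Yv, K v Yv ≠ 0 → ∀ j, cl (Yv j) = v) (Nv : Fin n → ℝ) (hN0 : ∀ u, 0 ≤ Nv u)
    (hN : ∀ u (j : Fin (deg u)) (a : Γ), ∑ Yu ∈ univ.filter (fun Yu : Fin (deg u) → Γ => Yu j = a), ‖K u Yu‖ ≤ Nv u)
    {α : ℝ} (hα : 0 ≤ α) (hrow : ∀ ℓ X, ∑ Y, ‖typeRestrict C cl ℓ X Y‖ ≤ α) (hcol : ∀ ℓ Y, ∑ X, ‖typeRestrict C cl ℓ X Y‖ ≤ α)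
    {v₀ : Fin n} (j₀ : Fin (deg v₀)) {k : ℕ} (s : Script v₀ k) (hs : s.Valid) (hcov : univ.image s.y = univ) (w : Γ) :
    ∑ Ys ∈ univ.filter (fun Ys : (∀ v, Fin (deg v) → Γ) => Ys v₀ j₀ = w), (∏ u, ‖K u (Ys u)‖) *
        ‖kernel 𝕜 (((Script.treeFactor (pairLap 𝕜 C cl) s : laplacianAlgebra 𝕜 C cl) : Module.End 𝕜 (GrassmannAlgebra 𝕜 Γ))
          (genProd 𝕜 (flat Ys))) 0 Fin.elim0‖ ≤
      (κ ^ ((∑ v, deg v) - 2 * k) * ∏ u, Nv u) * ((s.lines.map fun ℓ => α * (pairDeg deg ℓ : ℝ)).prod * cubeIntegral (Fin n) ℝ (s.weight ℝ)) := by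
  set laps : List (DelOp Γ 𝕜) := s.lines.reverse.map fun ℓ => DelOp.lap (typeRestrict C cl ℓ) with hlaps
  set P := patSet laps (univ : Finset (Fin (∑ v, deg v))) with hP
  set Iw := cubeIntegral (Fin n) ℝ (s.weight ℝ) with hIw
  set e := (∑ v, deg v) - 2 * k with he
  set D := (α / 2) ^ k * ∏ u, Nv u with hD
  set p₀ : Fin (∑ v, deg v) := blockEmb deg v₀ j₀ with hp₀
  have hIw0 : 0 ≤ Iw := cubeIntegral_nonneg _ fun t ht => FermionicTree.eval_weight_nonneg s ht
  have hD0 : 0 ≤ D := mul_nonneg (pow_nonneg (by positivity) _) (prod_nonneg fun u _ => hN0 u)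
  have hG0 : ∀ Ys : ∀ v, Fin (deg v) → Γ, 0 ≤ ∏ u, ‖K u (Ys u)‖ := fun Ys => prod_nonneg fun u _ => norm_nonneg _
  -- the Gram bound per label family
  have h1 : ∀ Ys : ∀ v, Fin (deg v) → Γ, (∏ u, ‖K u (Ys u)‖) *
      ‖kernel 𝕜 (((Script.treeFactor (pairLap 𝕜 C cl) s : laplacianAlgebra 𝕜 C cl) : Module.End 𝕜 (GrassmannAlgebra 𝕜 Γ))
        (genProd 𝕜 (flat Ys))) 0 Fin.elim0‖ ≤
      ∑ π ∈ P, (κ ^ e * Iw) * (kerProd K (flat Ys) * patWeight (flat Ys) laps π) := by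
    intro Ys
    have h := norm_kernel_treeFactor_genProd_le_of_gramBounded C cl hκ hGB s hs (flat Ys) (Fin.elim0 : Fin 0 → Γ)
    rw [scriptOps_elim0, ← hlaps, ← hP, Nat.factorial_zero, Nat.cast_one, inv_one, one_mul, zero_add, ← he, ← hIw] at h
    refine (mul_le_mul_of_nonneg_left h (hG0 Ys)).trans (le_of_eq ?_)
    rw [sum_mul, mul_sum, kerProd_flat]
    exact sum_congr rfl fun π _ => by ring
  -- count of the admissible patterns
  have hcount : ((P.filter fun π => stepsOK (s.lines.reverse.map (lapPred deg)) π).card : ℝ) ≤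
      (((s.lines.reverse.map fun ℓ => 2 * pairDeg deg ℓ).prod : ℕ) : ℝ) := by
    set L : List (DelOp Γ 𝕜 × (Fin (∑ v, deg v) × Fin (∑ v, deg v) → Bool) × (ℕ → ℕ)) :=
      s.lines.reverse.map fun ℓ => (DelOp.lap (typeRestrict C cl ℓ), lapPred deg ℓ, fun _ => 2 * pairDeg deg ℓ) with hL
    have hfst : L.map Prod.fst = laps := by rw [hL, hlaps, List.map_map]; rfl
    have hpred : L.map (fun x => x.2.1) = s.lines.reverse.map (lapPred deg) := by rw [hL, List.map_map]; rfl
    have hbd : L.map (fun x => (x.1, x.2.2)) = s.lines.reverse.map fun ℓ => ((DelOp.lap (typeRestrict C cl ℓ) : DelOp Γ 𝕜), fun _ => 2 * pairDeg deg ℓ) := by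
      rw [hL, List.map_map]; rfl
    have hB : ∀ x ∈ L, ∀ S' : Finset (Fin (∑ v, deg v)), ((DelOp.stepSet S' x.1).filter fun pq => x.2.1 pq).card ≤ x.2.2 S'.card := by
      intro x hx S'
      rw [hL, List.mem_map] at hx
      obtain ⟨ℓ, -, rfl⟩ := hx
      exact card_filter_lapPred_le S' _ ℓ
    have h := card_filter_patSet_le L hB univ
    rw [hfst, hpred, hbd, countBound_consts] at h
    exact_mod_cast h
  have hprod : (s.lines.map fun ℓ => α * (pairDeg deg ℓ : ℝ)).prod =
      (α / 2) ^ k * (((s.lines.reverse.map fun ℓ => 2 * pairDeg deg ℓ).prod : ℕ) : ℝ) := by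
    rw [Nat.cast_list_prod, List.map_map, List.map_reverse, List.prod_reverse,
      show (fun ℓ => α * (pairDeg deg ℓ : ℝ)) = fun ℓ => (α / 2) * ((Nat.cast : ℕ → ℝ) ∘ fun ℓ => 2 * pairDeg deg ℓ) ℓ from
        funext fun ℓ => by simp only [Function.comp_apply, Nat.cast_mul, Nat.cast_ofNat]; ring,
      List.prod_map_mul, List.map_const', List.prod_replicate, Script.length_lines]
  -- the pinned label sum of one pattern, reindexed by position labellings
  have hpin : ∀ π ∈ P, ∑ Ys ∈ univ.filter (fun Ys : (∀ v, Fin (deg v) → Γ) => Ys v₀ j₀ = w),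
      kerProd K (flat Ys) * patWeight (flat Ys) laps π ≤ (if stepsOK (s.lines.reverse.map (lapPred deg)) π then 1 else 0) * D := by
    intro π _
    have heq : ∑ Ys ∈ univ.filter (fun Ys : (∀ v, Fin (deg v) → Γ) => Ys v₀ j₀ = w), kerProd K (flat Ys) * patWeight (flat Ys) laps π =
        ∑ x ∈ univ.filter (fun x : Fin (∑ v, deg v) → Γ => x p₀ = w), kerProd K x * patWeight x laps π := by
      refine sum_equiv (flatEquiv deg) (fun Ys => ?_) (fun Ys _ => rfl)
      simp only [mem_filter, mem_univ, true_and, flatEquiv_apply, hp₀, flat_blockEmb]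
    rw [heq]
    exact sum_filter_kerProd_mul_patWeight_laps_le C cl K hK Nv hN0 hN hα hrow hcol s hs hcov π p₀ (vert_blockEmb deg v₀ j₀) w
  calc ∑ Ys ∈ univ.filter (fun Ys : (∀ v, Fin (deg v) → Γ) => Ys v₀ j₀ = w), (∏ u, ‖K u (Ys u)‖) *
          ‖kernel 𝕜 (((Script.treeFactor (pairLap 𝕜 C cl) s : laplacianAlgebra 𝕜 C cl) : Module.End 𝕜 (GrassmannAlgebra 𝕜 Γ))
            (genProd 𝕜 (flat Ys))) 0 Fin.elim0‖
      ≤ ∑ Ys ∈ univ.filter (fun Ys : (∀ v, Fin (deg v) → Γ) => Ys v₀ j₀ = w),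
          ∑ π ∈ P, (κ ^ e * Iw) * (kerProd K (flat Ys) * patWeight (flat Ys) laps π) := sum_le_sum fun Ys _ => h1 Ys
    _ = (κ ^ e * Iw) * ∑ π ∈ P, ∑ Ys ∈ univ.filter (fun Ys : (∀ v, Fin (deg v) → Γ) => Ys v₀ j₀ = w),
          kerProd K (flat Ys) * patWeight (flat Ys) laps π := by
        rw [sum_comm, mul_sum]
        exact sum_congr rfl fun π _ => by rw [mul_sum]
    _ ≤ (κ ^ e * Iw) * ∑ π ∈ P, (if stepsOK (s.lines.reverse.map (lapPred deg)) π then 1 else 0) * D :=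
        mul_le_mul_of_nonneg_left (sum_le_sum hpin) (by positivity)
    _ = (κ ^ e * Iw) * (((P.filter fun π => stepsOK (s.lines.reverse.map (lapPred deg)) π).card : ℝ) * D) := by
        rw [← sum_mul, ← sum_boole]
    _ ≤ (κ ^ e * Iw) * ((((s.lines.reverse.map fun ℓ => 2 * pairDeg deg ℓ).prod : ℕ) : ℝ) * D) :=
        mul_le_mul_of_nonneg_left (mul_le_mul_of_nonneg_right hcount hD0) (by positivity)
    _ = (κ ^ e * ∏ u, Nv u) * ((s.lines.map fun ℓ => α * (pairDeg deg ℓ : ℝ)).prod * Iw) := by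
        rw [hprod, hD]
        ring

/-- (Twin of `norm_kernel_zero_ursellOf_kernelVertex_le` under `IsGramBounded`.) **The vacuum bound** (Benfatto–Giuliani–Mastropietro 2006, (2.77)–(2.80) with no external legs): for `n` even
kernel vertices supported on their clusters, a root vertex `v₀` with a field `j₀`, and any `λ > 0`,
`‖kernel_0 𝓔ᵀ_C(M_0,…,M_{n-1})‖ ≤ |Γ| · κ^{N-2(n-1)} (∏_v N_v) · λ^{-(n-1)} ∏_ℓ (1 + λ α m m'_ℓ)` — the position of the
pinned root field costs the volume. [cite: BenfattoGiulianiMastropietro2006, (2.77)-(2.80)] -/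
theorem norm_kernel_zero_ursellOf_kernelVertex_le_of_gramBounded {κ : ℝ} (hκ : 0 ≤ κ) (hGB : IsGramBounded C κ)
    (hm : ∀ v, Even (deg v)) (hK : ∀ v Yv, K v Yv ≠ 0 → ∀ j, cl (Yv j) = v) (Nv : Fin n → ℝ) (hN0 : ∀ u, 0 ≤ Nv u)
    (hN : ∀ u (j : Fin (deg u)) (a : Γ), ∑ Yu ∈ univ.filter (fun Yu : Fin (deg u) → Γ => Yu j = a), ‖K u Yu‖ ≤ Nv u)
    {α : ℝ} (hα : 0 ≤ α) (hrow : ∀ ℓ X, ∑ Y, ‖typeRestrict C cl ℓ X Y‖ ≤ α) (hcol : ∀ ℓ Y, ∑ X, ‖typeRestrict C cl ℓ X Y‖ ≤ α) {lam : ℝ} (hlam : 0 < lam)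
    (v₀ : Fin n) (j₀ : Fin (deg v₀)) :
    ‖kernel 𝕜 ((ursellOf (convMoment 𝕜 C (kernelVertex 𝕜 hm K)) univ : evenPart 𝕜 Γ) : GrassmannAlgebra 𝕜 Γ) 0 Fin.elim0‖ ≤
      (Fintype.card Γ : ℝ) * ((κ ^ ((∑ v, deg v) - 2 * (n - 1)) * ∏ u, Nv u) *
        ((lam⁻¹) ^ (n - 1) * ∏ ℓ : Sym2 (Fin n), (1 + lam * (α * (pairDeg deg ℓ : ℝ))))) := by
  have hn : 0 < n := Fin.pos v₀
  set y : Sym2 (Fin n) → ℝ := fun ℓ => α * (pairDeg deg ℓ : ℝ) with hy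
  have hy0 : ∀ ℓ, 0 ≤ y ℓ := fun ℓ => mul_nonneg hα (Nat.cast_nonneg _)
  have hNv : 0 ≤ ∏ u, Nv u := prod_nonneg fun u _ => hN0 u
  set T : ∀ k : ℕ, Script v₀ k → (∀ v, Fin (deg v) → Γ) → ℝ := fun k s Ys =>
    ‖kernel 𝕜 (((Script.treeFactor (pairLap 𝕜 C cl) s : laplacianAlgebra 𝕜 C cl) : Module.End 𝕜 (GrassmannAlgebra 𝕜 Γ))
      (genProd 𝕜 (flat Ys))) 0 Fin.elim0‖ with hT
  set B : ℕ → ℝ := fun k => κ ^ ((∑ v, deg v) - 2 * k) * ∏ u, Nv u with hB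
  have hB0 : ∀ k, 0 ≤ B k := fun k => mul_nonneg (pow_nonneg hκ _) hNv
  calc ‖kernel 𝕜 ((ursellOf (convMoment 𝕜 C (kernelVertex 𝕜 hm K)) univ : evenPart 𝕜 Γ) : GrassmannAlgebra 𝕜 Γ) 0 Fin.elim0‖
      ≤ ∑ Ys : (∀ v, Fin (deg v) → Γ), (∏ u, ‖K u (Ys u)‖) * ∑ k ∈ range n, ∑ s : Script v₀ k,
          if s.Valid ∧ univ.image s.y = univ then T k s Ys else 0 :=
        norm_kernel_ursellOf_kernelVertex_le C cl K hm hK v₀ 0 Fin.elim0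
    _ = ∑ k ∈ range n, ∑ s : Script v₀ k, ∑ w : Γ, ∑ Ys ∈ univ.filter (fun Ys : (∀ v, Fin (deg v) → Γ) => Ys v₀ j₀ = w),
          (∏ u, ‖K u (Ys u)‖) * (if s.Valid ∧ univ.image s.y = univ then T k s Ys else 0) := by
        calc ∑ Ys : (∀ v, Fin (deg v) → Γ), (∏ u, ‖K u (Ys u)‖) * ∑ k ∈ range n, ∑ s : Script v₀ k,
                (if s.Valid ∧ univ.image s.y = univ then T k s Ys else 0)
            = ∑ Ys : (∀ v, Fin (deg v) → Γ), ∑ k ∈ range n, ∑ s : Script v₀ k,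
                (∏ u, ‖K u (Ys u)‖) * (if s.Valid ∧ univ.image s.y = univ then T k s Ys else 0) :=
              sum_congr rfl fun Ys _ => by
                rw [mul_sum]
                exact sum_congr rfl fun k _ => mul_sum _ _ _
          _ = ∑ k ∈ range n, ∑ Ys : (∀ v, Fin (deg v) → Γ), ∑ s : Script v₀ k,
                (∏ u, ‖K u (Ys u)‖) * (if s.Valid ∧ univ.image s.y = univ then T k s Ys else 0) := sum_comm
          _ = ∑ k ∈ range n, ∑ s : Script v₀ k, ∑ Ys : (∀ v, Fin (deg v) → Γ),
                (∏ u, ‖K u (Ys u)‖) * (if s.Valid ∧ univ.image s.y = univ then T k s Ys else 0) :=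
              sum_congr rfl fun k _ => sum_comm
          _ = _ := sum_congr rfl fun k _ => sum_congr rfl fun s _ =>
              (sum_fiberwise univ (fun Ys : (∀ v, Fin (deg v) → Γ) => Ys v₀ j₀) _).symm
    _ ≤ ∑ k ∈ range n, ∑ s : Script v₀ k, ∑ _w : Γ, (if s.Valid ∧ univ.image s.y = univ then
          B k * ((s.lines.map y).prod * cubeIntegral (Fin n) ℝ (s.weight ℝ)) else 0) := by
        refine sum_le_sum fun k _ => sum_le_sum fun s _ => sum_le_sum fun w _ => ?_
        split_ifs with h
        · exact sum_filter_norm_kernel_zero_treeFactor_le_of_gramBounded C cl K hκ hGB hK Nv hN0 hN hα hrow hcol j₀ s h.1 h.2 w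
        · simp
    _ = (Fintype.card Γ : ℝ) * ∑ k ∈ range n, ∑ s : Script v₀ k, (if s.Valid ∧ univ.image s.y = univ then
          B k * ((s.lines.map y).prod * cubeIntegral (Fin n) ℝ (s.weight ℝ)) else 0) := by
        rw [mul_sum]
        refine sum_congr rfl fun k _ => ?_
        rw [mul_sum]
        refine sum_congr rfl fun s _ => ?_
        rw [sum_const, card_univ, nsmul_eq_mul]
    _ = (Fintype.card Γ : ℝ) * ∑ s : Script v₀ (n - 1), (if s.Valid ∧ univ.image s.y = univ then
          B (n - 1) * ((s.lines.map y).prod * cubeIntegral (Fin n) ℝ (s.weight ℝ)) else 0) := by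
        rw [sum_eq_single (n - 1)]
        · intro k _ hk
          refine sum_eq_zero fun s _ => if_neg ?_
          rintro ⟨hs, hcov⟩
          have h := Script.card_image_y s hs
          rw [hcov, card_univ, Fintype.card_fin] at h
          omega
        · intro h
          exact absurd (mem_range.2 (by omega)) h
    _ ≤ (Fintype.card Γ : ℝ) * (B (n - 1) * ∑ s : Script v₀ (n - 1),
          (if s.Valid then (s.lines.map y).prod * cubeIntegral (Fin n) ℝ (s.weight ℝ) else 0)) := by
        refine mul_le_mul_of_nonneg_left ?_ (Nat.cast_nonneg _)
        rw [mul_sum]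
        refine sum_le_sum fun s _ => ?_
        have h0 := Script.prod_mul_weight_nonneg s y hy0
        by_cases hv : s.Valid
        · by_cases hc : univ.image s.y = univ
          · simp [hv, hc]
          · simp only [hv, hc, and_false, if_false, if_true]
            rw [if_pos hv] at h0
            exact mul_nonneg (hB0 _) h0
        · simp [hv]
    _ ≤ (Fintype.card Γ : ℝ) * (B (n - 1) * ((lam⁻¹) ^ (n - 1) * ∏ ℓ : Sym2 (Fin n), (1 + lam * y ℓ))) :=
        mul_le_mul_of_nonneg_left (mul_le_mul_of_nonneg_left
          (sum_prod_mul_weight_le_of_scale y hy0 v₀ hlam (by rw [Fintype.card_fin]; omega)) (hB0 _)) (Nat.cast_nonneg _)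

end Literature.MathematicalPhysics.QuantumLattice

end
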